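import Summits.HubbardSuperconductivity.HubbardSuperconductivity.Theses.AbelianDuality
import Summits.HubbardSuperconductivity.HubbardSuperconductivity.Theorems.LogColdTorusUniformDescent
import Literature.MathematicalPhysics.QuantumLattice.ApproximatingHamiltonianProofs
import Literature.MathematicalPhysics.QuantumLattice.ApproximateEigenvectorLemmas
import Literature.MathematicalPhysics.QuantumLattice.DWaveSourceProofs
import Literature.MathematicalPhysics.QuantumLattice.HubbardHubbardModelProofs
import Literature.MathematicalPhysics.QuantumLattice.LatticeToriProofs

/-!
# Route `AbelianDuality` — support `ThermalToGroundAverage` (stmt-HubbardSuperconductivity-1638)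

`ThermalToGroundAverage : SectorDWaveBKTBound → Thesis`. Keep `δ` and the window `(U₁, U₂)` of the
BKT bound; fix `U` in the window and an even side `L ≥ max L₀ L₁`. Write `ω_β` for the Gibbs state
of the sector-compressed torus Hamiltonian `H.toBlock p p` (Hermitian) and `P_x = localPair d L x`.

* LINEARITY: `(Δ_dᴴ Δ_d).toBlock p p = Σ_{x,y} ((P_x)ᴴ P_y).toBlock p p` (`Δ_d = Σ_x P_x`), so
  `re ω_β = Σ_{x,y} re ω_β(((P_x)ᴴ P_y).toBlock p p)`.
* FAR PAIRS (`torusDist x y ≥ R₀`): the hypothesis gives `re ω_β ≥ c (d+1)^{-C/β} ≥ c/2` as soon as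
  `β ≥ C (log L + 1)/log 2` (`d + 1 ≤ L`).
* NEAR PAIRS: `|re ω_β(X)| ≤ ‖X‖` for a state (`abs_re_gibbsState_le`), compression does not
  increase the operator norm (`norm_toBlock_le`, proved here), and `‖(P_x)ᴴ P_y‖ ≤ K²`,
  `K = 2 Σ_e |d(e)/√2|` (`norm_localPair_le`); at most `(2R₀+1)²` sites `y` are near a given `x`
  (`card_filter_torusDist_le`).
* SUM: `re ω_β(Δ_dᴴΔ_d block) ≥ (c/2) L⁴ - (c/2 + K²)(2R₀+1)² L² ≥ (c/4) L⁴` for `L ≥ L₁`.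
* `β → ∞` at fixed `L`: `le_re_groundStateFunctional_of_forall_ge` (zero-temperature limit of the
  Gibbs state of a Hermitian matrix, `Theorems/LogColdTorusUniformDescent.lean`).

Sources: H. Tasaki, Physics and Mathematics of Quantum Many-Body Systems (2020), App. A
(Gibbs → ground-state functional); T. Koma, H. Tasaki, PRL 68 (1992) 3248. No new definitions.
-/

-- the mandated namespace `Summit.<Summit>.<Problem>.Theorems` repeats `HubbardSuperconductivity`
-- (single-problem summit, D-0017), which the `dupNamespace` linter flags on every declaration
set_option linter.dupNamespace false

namespace Summit.HubbardSuperconductivity.HubbardSuperconductivity.Theorems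

open Matrix Filter Finset
open scoped Matrix.Norms.L2Operator ComplexOrder Classical
open Literature.MathematicalPhysics.QuantumLattice Literature.Probability.LatticeModels

/-! ### Compression does not increase the operator norm -/

section BlockNorm

variable {n : Type*} [Fintype n]

/-- `re (star v ⬝ᵥ v) = Σ_i |v i|²`. [folklore] -/
theorem re_star_dotProduct_self_eq_sum_normSq (v : n → ℂ) :
    (star v ⬝ᵥ v).re = ∑ i, Complex.normSq (v i) := by
  simp only [dotProduct, Pi.star_apply, Complex.re_sum]
  refine Finset.sum_congr rfl fun j _ => ?_
  rw [Complex.star_def, ← Complex.normSq_eq_conj_mul_self, Complex.ofReal_re]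

/-- A sum over the subtype `{a // p a}` of a function vanishing off `p` is the full sum. [folklore] -/
theorem sum_subtype_eq_sum_of_zero {β : Type*} [AddCommMonoid β] (p : n → Prop) [Fintype {a // p a}]
    [DecidablePred p] (g : n → β) (hg : ∀ a, ¬ p a → g a = 0) :
    ∑ j : {a // p a}, g (j : n) = ∑ a, g a := by
  have hmem : ∀ a, a ∈ Finset.univ.filter p ↔ p a := fun a => by simp
  rw [← Finset.sum_subtype (Finset.univ.filter p) hmem (fun a => g a), Finset.sum_filter]
  refine Finset.sum_congr rfl fun a _ => ?_
  by_cases ha : p a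
  · rw [if_pos ha]
  · rw [if_neg ha, hg a ha]

/-- A sum over the subtype of a nonnegative real function is at most the full sum. [folklore] -/
theorem sum_subtype_le_sum (p : n → Prop) [Fintype {a // p a}] [DecidablePred p] (g : n → ℝ) (hg : ∀ a, 0 ≤ g a) :
    ∑ j : {a // p a}, g (j : n) ≤ ∑ a, g a := by
  have hmem : ∀ a, a ∈ Finset.univ.filter p ↔ p a := fun a => by simp
  rw [← Finset.sum_subtype (Finset.univ.filter p) hmem (fun a => g a)]
  exact Finset.sum_le_univ_sum_of_nonneg hg

/-- The compressed matrix acts as "extend by zero, multiply, restrict". [folklore] -/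
theorem toBlock_mulVec_apply (M : Matrix n n ℂ) (p : n → Prop) [Fintype {a // p a}]
    [DecidablePred p] (x : {a // p a} → ℂ) (xe : n → ℂ) (hxe : ∀ j : {a // p a}, x j = xe (j : n))
    (hxe0 : ∀ a, ¬ p a → xe a = 0) (i : {a // p a}) :
    (M.toBlock p p *ᵥ x) i = (M *ᵥ xe) (i : n) := by
  simp only [mulVec, dotProduct]
  calc ∑ j : {a // p a}, M (i : n) (j : n) * x j
      = ∑ j : {a // p a}, M (i : n) (j : n) * xe (j : n) :=
        Finset.sum_congr rfl fun j _ => by rw [hxe j]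
    _ = ∑ a, M (i : n) a * xe a :=
        sum_subtype_eq_sum_of_zero p (fun a => M (i : n) a * xe a)
          (fun a ha => by rw [hxe0 a ha, mul_zero])

/-- **Compression does not increase the `L²` operator norm**: `‖M.toBlock p p‖ ≤ ‖M‖` (restrict
after multiplying the zero extension; both steps are norm-non-increasing). [folklore] -/
theorem norm_toBlock_le [DecidableEq n] (M : Matrix n n ℂ) (p : n → Prop) [Fintype {a // p a}]
    [DecidablePred p] [DecidableEq {a // p a}] :
    ‖M.toBlock p p‖ ≤ ‖M‖ := by
  rw [Matrix.cstar_norm_def (M.toBlock p p)]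
  refine ContinuousLinearMap.opNorm_le_bound _ (norm_nonneg _) fun x => ?_
  set xe : n → ℂ := fun a => if h : p a then (WithLp.ofLp x) ⟨a, h⟩ else 0 with hxe_def
  have hxe : ∀ j : {a // p a}, (WithLp.ofLp x) j = xe (j : n) := fun j => by
    rw [hxe_def]; simp [dif_pos j.2]
  have hxe0 : ∀ a, ¬ p a → xe a = 0 := fun a ha => by rw [hxe_def]; simp [dif_neg ha]
  have h1 : ‖toEuclideanCLM (n := {a // p a}) (𝕜 := ℂ) (M.toBlock p p) x‖ =
      eucNorm (M.toBlock p p *ᵥ WithLp.ofLp x) := rfl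
  have hx : ‖x‖ = eucNorm (WithLp.ofLp x) := rfl
  rw [h1, hx]
  have hsq1 : eucNorm (M.toBlock p p *ᵥ WithLp.ofLp x) ^ 2 ≤ eucNorm (M *ᵥ xe) ^ 2 := by
    rw [eucNorm_sq, eucNorm_sq, re_star_dotProduct_self_eq_sum_normSq,
      re_star_dotProduct_self_eq_sum_normSq]
    have hterm : ∀ i : {a // p a}, Complex.normSq ((M.toBlock p p *ᵥ WithLp.ofLp x) i) =
        Complex.normSq ((M *ᵥ xe) (i : n)) := fun i => by
      rw [toBlock_mulVec_apply M p _ xe hxe hxe0]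
    simp only [hterm]
    exact sum_subtype_le_sum p (fun a => Complex.normSq ((M *ᵥ xe) a))
      fun a => Complex.normSq_nonneg _
  have hsq2 : eucNorm xe ^ 2 = eucNorm (WithLp.ofLp x) ^ 2 := by
    rw [eucNorm_sq, eucNorm_sq, re_star_dotProduct_self_eq_sum_normSq,
      re_star_dotProduct_self_eq_sum_normSq]
    have hrhs : ∑ i : {a // p a}, Complex.normSq ((WithLp.ofLp x) i) =
        ∑ i : {a // p a}, Complex.normSq (xe (i : n)) :=
      Finset.sum_congr rfl fun i _ => by rw [hxe i]
    rw [hrhs]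
    exact (sum_subtype_eq_sum_of_zero p (fun a => Complex.normSq (xe a))
      (fun a ha => by rw [hxe0 a ha, map_zero])).symm
  have hxe_eq : eucNorm xe = eucNorm (WithLp.ofLp x) := by
    have h := hsq2
    rwa [sq_eq_sq₀ (eucNorm_nonneg _) (eucNorm_nonneg _)] at h
  have h3 : eucNorm (M *ᵥ xe) ≤ ‖M‖ * eucNorm (WithLp.ofLp x) := by
    rw [← hxe_eq]; exact eucNorm_mulVec_le M xe
  have h4 : eucNorm (M.toBlock p p *ᵥ WithLp.ofLp x) ≤ eucNorm (M *ᵥ xe) :=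
    (pow_le_pow_iff_left₀ (eucNorm_nonneg _) (eucNorm_nonneg _) two_ne_zero).1 hsq1
  exact h4.trans h3

omit [Fintype n] in
/-- Compression is additive over finite sums. [folklore] -/
theorem toBlock_sum {ι : Type*} (s : Finset ι) (M : ι → Matrix n n ℂ) (p q : n → Prop) :
    (∑ i ∈ s, M i).toBlock p q = ∑ i ∈ s, (M i).toBlock p q := by
  ext a b
  simp [toBlock_apply, Matrix.sum_apply]

/-- **A state is bounded by the norm, on a block**: for the Gibbs state of a Hermitian block
Hamiltonian, `-‖X‖ ≤ re ω_β(X.toBlock p p)` (empty block: both functionals vanish). [folklore] -/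
theorem neg_norm_le_re_gibbsState_toBlock [DecidableEq n] {p : n → Prop} [Fintype {a // p a}]
    [DecidablePred p] [DecidableEq {a // p a}] {H : Matrix {a // p a} {a // p a} ℂ} (hH : H.IsHermitian) (β : ℝ) (X : Matrix n n ℂ) :
    -‖X‖ ≤ (Matrix.gibbsState β H (X.toBlock p p)).re := by
  rcases isEmpty_or_nonempty {a // p a} with hp | hp
  · have hX : X.toBlock p p = 0 := Subsingleton.elim _ _
    rw [hX, map_zero, Complex.zero_re, neg_nonpos]
    exact norm_nonneg _
  · have h := abs_re_gibbsState_le hH β (X.toBlock p p)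
    have h2 := norm_toBlock_le X p
    have h3 := neg_abs_le (Matrix.gibbsState β H (X.toBlock p p)).re
    linarith

end BlockNorm

/-! ### The far-pair bound: `c (d+1)^{-C/β} ≥ c/2` for log-large `β` -/

/-- For `1 ≤ t ≤ L`, `0 < C` and `β ≥ C (log L + 1) / log 2`: `(1/2) ≤ t ^ (-C/β)`. [folklore] -/
theorem half_le_rpow_neg_div {t Lr C β : ℝ} (ht : 1 ≤ t) (htL : t ≤ Lr) (hC : 0 < C)
    (hβ : C * (Real.log Lr + 1) / Real.log 2 ≤ β) : (1 : ℝ) / 2 ≤ t ^ (-C / β) := by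
  have hlog2 : 0 < Real.log 2 := Real.log_pos one_lt_two
  have hLr1 : 1 ≤ Lr := ht.trans htL
  have hlogL : 0 ≤ Real.log Lr := Real.log_nonneg hLr1
  have hβpos : 0 < β := by
    have : 0 < C * (Real.log Lr + 1) / Real.log 2 := by positivity
    linarith
  have ht0 : 0 < t := one_pos.trans_le ht
  rw [Real.rpow_def_of_pos ht0]
  have hhalf : (1 : ℝ) / 2 = Real.exp (-Real.log 2) := by
    rw [Real.exp_neg, Real.exp_log two_pos, one_div]
  rw [hhalf]
  apply Real.exp_le_exp.2
  -- goal: -log 2 ≤ log t * (-C/β), i.e. log t * C / β ≤ log 2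
  have hlogt : Real.log t ≤ Real.log Lr := Real.log_le_log ht0 htL
  have hlogt0 : 0 ≤ Real.log t := Real.log_nonneg ht
  have h1 : Real.log t * (C / β) ≤ Real.log Lr * (C / β) :=
    mul_le_mul_of_nonneg_right hlogt (by positivity)
  -- log Lr * C / β ≤ log 2 because β ≥ C (log Lr + 1)/log 2
  have h2 : Real.log Lr * (C / β) ≤ Real.log 2 := by
    rw [mul_div_assoc', div_le_iff₀ hβpos]
    have h3 : C * (Real.log Lr + 1) ≤ β * Real.log 2 := by
      rw [div_le_iff₀ hlog2] at hβ
      linarith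
    nlinarith
  have h4 : Real.log t * (-C / β) = -(Real.log t * (C / β)) := by ring
  rw [h4]
  linarith

/-! ### The sum estimate at fixed `β` -/

/-- **Sector Gibbs d-wave order from the pointwise far bound**, at one side and one `β`. Writing
`ω = gibbsState β (H.toBlock p p)`: if `re ω(((P_x)ᴴ P_y).toBlock p p) ≥ c/2` whenever
`R₀ ≤ torusDist x y`, then
`(c/2) L⁴ - (c/2 + K²)(2R₀+1)² L² ≤ re ω((Δ_dᴴ Δ_d).toBlock p p)`, `K = 2 Σ_e |d(e)/√2|`.
[folklore] -/
theorem re_gibbs_pairIntensity_toBlock_ge (L : ℕ) [NeZero L]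
    {p : Finset (Orb (FermionTorus 2 L)) → Prop} [Fintype {s // p s}] [DecidableEq {s // p s}]
    {H : Matrix {s // p s} {s // p s} ℂ} (hH : H.IsHermitian) (β c : ℝ) (hc : 0 ≤ c) (R₀ : ℕ)
    (hfar : ∀ x y : TorusSite 2 L, R₀ ≤ torusDist x y →
      c / 2 ≤ (Matrix.gibbsState β H ((((localPair dWaveFormFactor L x)ᴴ *
        localPair dWaveFormFactor L y)).toBlock p p)).re) :
    c / 2 * (L : ℝ) ^ 4 -
        (c / 2 + (2 * ∑ e ∈ insert (0 : Site 2) unitSteps, |dWaveFormFactor e / Real.sqrt 2|) ^ 2) *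
          ((2 * R₀ + 1) ^ 2 : ℕ) * (L : ℝ) ^ 2 ≤
      (Matrix.gibbsState β H (((pairField dWaveFormFactor L)ᴴ * pairField dWaveFormFactor L).toBlock
        p p)).re := by
  set K : ℝ := 2 * ∑ e ∈ insert (0 : Site 2) unitSteps, |dWaveFormFactor e / Real.sqrt 2| with hK
  set Mn : ℕ := (2 * R₀ + 1) ^ 2 with hMn
  set ω := Matrix.gibbsState β H with hω
  -- linearity
  have hlin : (ω (((pairField dWaveFormFactor L)ᴴ * pairField dWaveFormFactor L).toBlock p p)).re =
      ∑ x : TorusSite 2 L, ∑ y : TorusSite 2 L,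
        (ω (((localPair dWaveFormFactor L x)ᴴ * localPair dWaveFormFactor L y).toBlock p p)).re := by
    have hmat : (pairField dWaveFormFactor L)ᴴ * pairField dWaveFormFactor L =
        ∑ x : TorusSite 2 L, ∑ y : TorusSite 2 L,
          (localPair dWaveFormFactor L x)ᴴ * localPair dWaveFormFactor L y := by
      rw [pairField, conjTranspose_sum, Finset.sum_mul_sum]
    rw [hmat, toBlock_sum]
    simp only [toBlock_sum, map_sum, Complex.re_sum]
  rw [hlin]
  -- per-pair lower bound
  have hK0 : 0 ≤ K := by rw [hK]; positivity
  have hnormP : ∀ x : TorusSite 2 L, ‖localPair dWaveFormFactor L x‖ ≤ K := fun x =>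
    norm_localPair_le dWaveFormFactor L x
  have hpair : ∀ x y : TorusSite 2 L,
      c / 2 - (c / 2 + K ^ 2) * (if torusDist x y < R₀ then 1 else 0) ≤
        (ω (((localPair dWaveFormFactor L x)ᴴ * localPair dWaveFormFactor L y).toBlock p p)).re := by
    intro x y
    by_cases hd : torusDist x y < R₀
    · rw [if_pos hd, mul_one]
      have hn : ‖(localPair dWaveFormFactor L x)ᴴ * localPair dWaveFormFactor L y‖ ≤ K ^ 2 := by
        calc ‖(localPair dWaveFormFactor L x)ᴴ * localPair dWaveFormFactor L y‖
            ≤ ‖(localPair dWaveFormFactor L x)ᴴ‖ * ‖localPair dWaveFormFactor L y‖ := norm_mul_le _ _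
          _ = ‖localPair dWaveFormFactor L x‖ * ‖localPair dWaveFormFactor L y‖ := by
              rw [Matrix.l2_opNorm_conjTranspose]
          _ ≤ K * K := mul_le_mul (hnormP x) (hnormP y) (norm_nonneg _) hK0
          _ = K ^ 2 := by ring
      have hb := neg_norm_le_re_gibbsState_toBlock hH β
        ((localPair dWaveFormFactor L x)ᴴ * localPair dWaveFormFactor L y)
      rw [hω]
      linarith
    · rw [if_neg hd, mul_zero, sub_zero]
      exact hfar x y (not_lt.1 hd)
  -- counting the near sites
  have hnear : ∀ x : TorusSite 2 L,
      (∑ y : TorusSite 2 L, (if torusDist x y < R₀ then (1 : ℝ) else 0)) ≤ (Mn : ℝ) := by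
    intro x
    rw [Finset.sum_boole]
    have h1 : (Finset.univ.filter fun y : TorusSite 2 L => torusDist x y < R₀).card ≤
        (Finset.univ.filter fun y : TorusSite 2 L => torusDist x y ≤ R₀).card :=
      Finset.card_le_card (Finset.monotone_filter_right _ fun y _ h => le_of_lt h)
    have h2 := card_filter_torusDist_le L x R₀ (d := 2)
    rw [hMn]
    exact_mod_cast h1.trans h2
  have hcard : (Finset.univ : Finset (TorusSite 2 L)).card = L ^ 2 := by
    rw [Finset.card_univ]
    simp [TorusSite, ZMod.card]
  -- sum the per-pair bounds
  calc c / 2 * (L : ℝ) ^ 4 - (c / 2 + K ^ 2) * (Mn : ℝ) * (L : ℝ) ^ 2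
      = ∑ _x : TorusSite 2 L, (c / 2 * (L : ℝ) ^ 2 - (c / 2 + K ^ 2) * (Mn : ℝ)) := by
        rw [Finset.sum_const, hcard, nsmul_eq_mul]
        push_cast
        ring
    _ ≤ ∑ x : TorusSite 2 L, ∑ y : TorusSite 2 L,
          (c / 2 - (c / 2 + K ^ 2) * (if torusDist x y < R₀ then 1 else 0)) := by
        refine Finset.sum_le_sum fun x _ => ?_
        rw [Finset.sum_sub_distrib, Finset.sum_const, hcard, nsmul_eq_mul, ← Finset.mul_sum]
        push_cast
        have h := hnear x
        have hcK : 0 ≤ c / 2 + K ^ 2 := by positivity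
        nlinarith
    _ ≤ ∑ x : TorusSite 2 L, ∑ y : TorusSite 2 L,
          (ω (((localPair dWaveFormFactor L x)ᴴ * localPair dWaveFormFactor L y).toBlock p p)).re :=
        Finset.sum_le_sum fun x _ => Finset.sum_le_sum fun y _ => hpair x y

/-- **ThermalToGroundAverage** (item `stmt-HubbardSuperconductivity-1638`):
`SectorDWaveBKTBound → Thesis`, with the same `δ`, window, `c/4` and threshold
`max L₀ (⌈(4/c)(c/2 + K²)(2R₀+1)²⌉ + 1)`. Tasaki (2020) App. A; Koma–Tasaki (1992). [folklore] -/
theorem thermalToGroundAverage_proof :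
    Summit.HubbardSuperconductivity.HubbardSuperconductivity.Theses.AbelianDuality.ThermalToGroundAverage := by
  rintro ⟨δ, hδ, U₁, U₂, hU₁, hU₁₂, β₀, c, C, hβ₀, hc, hC, R₀, L₀, hBKT⟩
  set K : ℝ := 2 * ∑ e ∈ insert (0 : Site 2) unitSteps, |dWaveFormFactor e / Real.sqrt 2| with hK
  set Mn : ℕ := (2 * R₀ + 1) ^ 2 with hMn
  set T : ℝ := 4 / c * ((c / 2 + K ^ 2) * (Mn : ℝ)) with hT
  refine ⟨δ, hδ, U₁, U₂, hU₁, hU₁₂, c / 4, by positivity, max L₀ (⌈T⌉₊ + 1), ?_⟩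
  intro U hU L _ hL hEv p
  have hL0 : L₀ ≤ L := le_of_max_le_left hL
  have hLT : ⌈T⌉₊ + 1 ≤ L := le_of_max_le_right hL
  have hH : ((hubbardTorus 2 L 1 U).toBlock p p).IsHermitian :=
    (hubbardTorus_isHermitian (hamiltonian_isHermitian_and_commute_holds _) 1 U).submatrix _
  -- β-threshold: β ≥ β₀ and β ≥ C (log L + 1)/log 2
  refine LogColdTorus.le_re_groundStateFunctional_of_forall_ge hH _ _
    (max β₀ (C * (Real.log (L : ℝ) + 1) / Real.log 2)) fun β hβ => ?_
  have hβ0 : β₀ ≤ β := le_of_max_le_left hβ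
  have hβ1 : C * (Real.log (L : ℝ) + 1) / Real.log 2 ≤ β := le_of_max_le_right hβ
  -- far pairs: c/2 ≤ re ω
  have hfar : ∀ x y : TorusSite 2 L, R₀ ≤ torusDist x y →
      c / 2 ≤ (Matrix.gibbsState β ((hubbardTorus 2 L 1 U).toBlock p p)
        ((((localPair dWaveFormFactor L x)ᴴ * localPair dWaveFormFactor L y)).toBlock p p)).re := by
    intro x y hxy
    have h := hBKT U hU β hβ0 L hL0 hEv x y hxy
    dsimp only at h
    have hd1 : (1 : ℝ) ≤ (torusDist x y : ℝ) + 1 := by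
      have : (0 : ℝ) ≤ (torusDist x y : ℝ) := Nat.cast_nonneg _
      linarith
    have hdL : (torusDist x y : ℝ) + 1 ≤ (L : ℝ) := by
      have := torusDist_lt x y
      exact_mod_cast this
    have hhalf := half_le_rpow_neg_div hd1 hdL hC hβ1
    have : c / 2 ≤ c * ((torusDist x y : ℝ) + 1) ^ (-C / β) := by
      have := mul_le_mul_of_nonneg_left hhalf hc.le
      linarith
    exact this.trans h
  have hsum := re_gibbs_pairIntensity_toBlock_ge L hH β c hc.le R₀ hfar
  -- threshold arithmetic: (c/4) L⁴ ≤ (c/2) L⁴ - (c/2 + K²) Mn L²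
  have hLreal : T ≤ (L : ℝ) := by
    have h1 : T ≤ (⌈T⌉₊ : ℝ) := Nat.le_ceil T
    have h2 : ((⌈T⌉₊ + 1 : ℕ) : ℝ) ≤ (L : ℝ) := by exact_mod_cast hLT
    push_cast at h2
    linarith
  have hL1 : (1 : ℝ) ≤ (L : ℝ) := by
    have : 1 ≤ L := le_trans (by omega) hLT
    exact_mod_cast this
  have hL2 : T ≤ (L : ℝ) ^ 2 := hLreal.trans (by nlinarith)
  have hkey : c / 4 * (L : ℝ) ^ 4 ≤
      c / 2 * (L : ℝ) ^ 4 - (c / 2 + K ^ 2) * (Mn : ℝ) * (L : ℝ) ^ 2 := by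
    -- (c/2 + K²) Mn ≤ (c/4) L²  since  L² ≥ T = (4/c)(c/2+K²)Mn
    have h1 : (c / 2 + K ^ 2) * (Mn : ℝ) ≤ c / 4 * (L : ℝ) ^ 2 := by
      rw [hT] at hL2
      have h := mul_le_mul_of_nonneg_left hL2 (show 0 ≤ c / 4 by positivity)
      have h' : c / 4 * (4 / c * ((c / 2 + K ^ 2) * (Mn : ℝ))) = (c / 2 + K ^ 2) * (Mn : ℝ) := by
        field_simp
      linarith
    have hL2nn : 0 ≤ (L : ℝ) ^ 2 := by positivity
    nlinarith
  exact hkey.trans hsum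

end Summit.HubbardSuperconductivity.HubbardSuperconductivity.Theorems
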